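import Summits.Ventures.QEC.Census.BB.A1s_n162_k12_a0a80268.Data
import HarnessLib

/-!
# Census row `A1s_n162_k12_a0a80268` — Brouwer–Zimmermann block verdicts 9…17 of the `Z` side (827658 codeword visits; fast twin `bzZBlockF`, `decide +kernel`, tier KERNEL). Part 2/3.
-/

set_option Elab.async false

namespace Summit.Ventures.QEC.Census.A1s_n162_k12_a0a80268

/-- Block 9 of the `Z` side replays (91962 codeword visits; fast twin `bzZBlockF`, `decide +kernel`). -/
theorem blkZ_9 : A1s_n162_k12_a0a80268.cert.bzZBlockF A1s_n162_k12_a0a80268.bz 9 = true := by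
  decide +kernel

/-- Block 10 of the `Z` side replays (91962 codeword visits; fast twin `bzZBlockF`, `decide +kernel`). -/
theorem blkZ_10 : A1s_n162_k12_a0a80268.cert.bzZBlockF A1s_n162_k12_a0a80268.bz 10 = true := by
  decide +kernel

/-- Block 11 of the `Z` side replays (91962 codeword visits; fast twin `bzZBlockF`, `decide +kernel`). -/
theorem blkZ_11 : A1s_n162_k12_a0a80268.cert.bzZBlockF A1s_n162_k12_a0a80268.bz 11 = true := by
  decide +kernel

/-- Block 12 of the `Z` side replays (91962 codeword visits; fast twin `bzZBlockF`, `decide +kernel`). -/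
theorem blkZ_12 : A1s_n162_k12_a0a80268.cert.bzZBlockF A1s_n162_k12_a0a80268.bz 12 = true := by
  decide +kernel

/-- Block 13 of the `Z` side replays (91962 codeword visits; fast twin `bzZBlockF`, `decide +kernel`). -/
theorem blkZ_13 : A1s_n162_k12_a0a80268.cert.bzZBlockF A1s_n162_k12_a0a80268.bz 13 = true := by
  decide +kernel

/-- Block 14 of the `Z` side replays (91962 codeword visits; fast twin `bzZBlockF`, `decide +kernel`). -/
theorem blkZ_14 : A1s_n162_k12_a0a80268.cert.bzZBlockF A1s_n162_k12_a0a80268.bz 14 = true := by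
  decide +kernel

/-- Block 15 of the `Z` side replays (91962 codeword visits; fast twin `bzZBlockF`, `decide +kernel`). -/
theorem blkZ_15 : A1s_n162_k12_a0a80268.cert.bzZBlockF A1s_n162_k12_a0a80268.bz 15 = true := by
  decide +kernel

/-- Block 16 of the `Z` side replays (91962 codeword visits; fast twin `bzZBlockF`, `decide +kernel`). -/
theorem blkZ_16 : A1s_n162_k12_a0a80268.cert.bzZBlockF A1s_n162_k12_a0a80268.bz 16 = true := by
  decide +kernel

/-- Block 17 of the `Z` side replays (91962 codeword visits; fast twin `bzZBlockF`, `decide +kernel`). -/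
theorem blkZ_17 : A1s_n162_k12_a0a80268.cert.bzZBlockF A1s_n162_k12_a0a80268.bz 17 = true := by
  decide +kernel

end Summit.Ventures.QEC.Census.A1s_n162_k12_a0a80268
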